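import Summits.Ventures.HSemireg.Pad4TowerSeedB1Odd

/-!
# Venture HSemireg — PAD-4 on 𝔅(μ₄): SPAN CONTROL of the static H₁ game, part 1∕2 — the h-uniform family, the boost, the glue (lens «control» LINE 1)

HONEST FRAMING. Lean index of the computation cell `pub-hsemireg` (S4-PUSH, H2 door PAD-4, line stmt-HodgeConjecture-18881 `BlochSeedDiscOne`,
skeleton `Cruxes/BlochSeedDiscOne/Lines/birth.lean` 814a6a70c14e831a, STUB R NEGATIVE SIDE ∕ instrument), written by the lens ideator
`plan-lens-HodgeAV-control` (g0 author of the mathematics, g2 of this landing) on director-hodge R16.6 (1) and the critic of record's ruling L1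
(idea-crit-6 g3, PASS-WITH-PRICE R14.37; P2′: «K1 needs no prover; its landing = an HSemireg support file»). Census-neutral: theorems ABOUT THE TYPED
STATIC PREDICATES of record (`StaticH1 = RuleDMu4Closed ∧ XPlusClosed ∧ A2IMinusClosed`, `G1Closed`, `HasOddFC` of `Pad4TowerSeedB1`, `InDiamond h` of
`Pad4TowerDiamondMu4`); nothing here is an object, a σ, a seed or a census row; NOTHING HERE SAYS THAT HC ∕ HC_CM ∕ HC_AV ∕ H2 HOLDS OR FAILS, and
nothing here decides the typed target of record `(T_8) = SeedB1OddDiamond8G1H1` (machine ×2 on the encoder + third code ×1 at `h = 8`; not a kernel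
theorem). No `sorry`, no `axiom`, no `instance`, no notation, no Literature fact. Width toward H2 = 0 (critic price P1).

WHAT (Sketch `Cruxes/BlochSeedDiscOne/B1OddSpanControl.lean` v5 651a2b039531c043; section numbers are the Sketch's; §4–§5 = the kernel probes of
falsifier F3 stay in the Cruxes workfile; §7–§9 = part 2 `Pad4TowerB1OddBoostBlind`):
* §1 the h-uniform family `SeedB1OddDiamondG1H1 h` (`h = 8` is `(T)`: `seedB1OddDiamondG1H1_eight`), ANTITONE in `h` (`seedB1OddDiamondG1H1_antitone`);
  the open-cone statement `(T_∞) = SeedB1OddConeG1H1`; `SeedB1OddConeIff : (T_∞) ↔ ∀ h, (T_h)` (proved §6). CONTROLLING QUANTITY: `StaticH1`, `G1Closed`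
  and `HasOddFC` never mention `h` — only `InDiamond h` does — so the tower `(T_h)` is ONE decreasing truth-function of `h`, i.e. the single number
  `s_odd = min span of a static G₁-closed two-level support carrying an odd FC cell ∈ 2ℕ ∪ {∞}`, `(T_h) ↔ h < s_odd`.
* §2 the light-cone BOOST `α ↦ α + s`, `β` fixed (`boostPt`, `MCell.boost`, `MConfig.boostImage`); the FIRST LEMMA `StaticH1BoostInvariant` (H₁, G₁ and
  odd-FC presence are boost-blind between cone configurations — PROVED in part 2); `FloorAnchored`, `SeedB1OddAnchored h`, `SpanControl`.
* §3 realisable diagonal units `DiagUnitRealisable h t` (monotone in `h`), `DiagUnitRealisableBoost`, and the boost-consistent h-uniform sharpening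
  **(DUL-h)** `SeedFCDiagonalDiamondG1H1 h` («every FC cell of a static G₁-closed ◇_h support is diagonal»; at `h = 8` = j309715's «≥ 2 distinct letters»
  UNSAT, third code ×1) with `seedB1Odd_of_diagonal : (DUL-h) → (T_h)` — the uniform sentence of record after (CUL-h ≥ 10) was withdrawn (R16.2 (2)).
* §6 GLUE PROVED: the boost is injective and commutes with `perm` ∕ `delta` ∕ `pat` ∕ `FCc`, so the `G1Closed` and `HasOddFC` conjuncts of the first lemma
  hold outright (`g1Closed_boost_iff`, `hasOddFC_boost_iff`) and K1 reduces to `StaticH1BoostCore`; **`spanControl`** (boost a counterexample down by its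
  minimal node level: under the first lemma `(T_h)` ⟺ its FLOOR-ANCHORED form, so the only parameter of a counterexample is its SPAN), **`seedB1OddConeIff`**
  (a finite support lies in the diamond of its maximal causal height), `diagUnitRealisableBoost`, `diagUnits_next_height` (conditional on the core).

CENSUS ROWS READ (card `hodge-bloch-bc5-plan` birth-v4.md v4.20 89eec435285875a9): W16 (j305149: H₁ = H_odd = H₂ = RULE-D + {X+, A2I−} ×2), W17 (third code j309715
«odd FC» UNSAT + DRAT VERIFIED; peel j309861: sole FC survivor `P[6I+ℓ_u]⁴`; DRUP peel j310751), W18 ((W) ×2 j310554), W19 (◇₁₀ j308425), W22 (◇₁₀ third code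
j313137, PREREG dd6eeaf705c32404, whose SOUNDNESS ROW 4 is part 2's `diagUnits_next_height_holds`). Falsifiers (HOME `pub/ideators/plan-lens-HodgeAV-control/pred/`):
F1 ◇₆ = D6 457cd93c5f785a00, F2 ◇₁₀ ⊇ D10 6648ccaea2744931, F3 PASSED (Cruxes workfile §5). SOURCES: `Pad4TowerSeedB1Odd` ((T), `OddPat`), `Pad4TowerSeedB1`
(`MConfig`, `StaticH1`, `G1Closed`, `HasOddFC`), `Pad4TowerDiamondMu4` (`InDiamond`, `OnFloor`, `OnCeiling`, `absCharge`); translation principle (11.4)(A) of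
bc5-plan memo v4.3 (×1 s4-ref g75 790ea02da880472c); card `Cruxes/BlochSeedDiscOne/Ideas/b1odd-span-control.md` v1.2; idea-crit-6 verdicts/07; cell INBOX
l.32807 ∕ l.32839 ∕ l.32862 ∕ l.32953; ideators/idea-crit-6 INBOX 15:31Z–16:07Z (L1, R14.37, R16.6). Typed ≠ proved for `(T_8)`. -/

namespace Summit.Ventures.HSemireg.Pad4Tower

open Finset

/-! ## §1 The h-uniform family and the cone statement -/

/-- **(T_h)**: the typed target of record with the height as a parameter (`h = 8` is `SeedB1OddDiamond8G1H1`). -/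
def SeedB1OddDiamondG1H1 (h : ℤ) : Prop :=
  ∀ C : MConfig, C.InDiamond h → C.G1Closed → C.StaticH1 → ¬ C.HasOddFC
/-- `(T_8)` is the target of record, definitionally. -/
theorem seedB1OddDiamondG1H1_eight : SeedB1OddDiamondG1H1 8 ↔ SeedB1OddDiamond8G1H1 := Iff.rfl
/-- a letter of the OPEN CONE (no ceiling): μ₄ phase or apex, node level `t = α − c ≥ 0` even. -/
abbrev InCone (x : BPoint) : Prop := (x.2 = (0, 0) ∨ AxisPt x) ∧ absCharge x ≤ x.1 ∧ (x.1 - absCharge x) % 2 = 0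
/-- every letter of every cell of `C` lies in the open cone. -/
abbrev MConfig.InCone (C : MConfig) : Prop :=
  (∀ Z ∈ C.lower, ∀ f, Pad4Tower.InCone (Z f)) ∧ ∀ P ∈ C.upper, ∀ f, Pad4Tower.InCone (P f)
/-- **(T_∞) THE h-UNIFORM STATEMENT**: no static G₁-closed two-level support in the open cone carries an odd FC cell. -/
def SeedB1OddConeG1H1 : Prop := ∀ C : MConfig, C.InCone → C.G1Closed → C.StaticH1 → ¬ C.HasOddFC
/-- `◇_h ⊆ ◇_{h'}` for `h ≤ h'`, letterwise. -/
theorem inDiamond_mono {h h' : ℤ} (hh : h ≤ h') {x : BPoint} (hx : InDiamond h x) : InDiamond h' x :=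
  ⟨hx.1, hx.2.1, hx.2.2.1, le_trans hx.2.2.2 hh⟩
/-- **(MONO)** the targets decrease in `h`: a larger diamond is a stronger statement. -/
theorem seedB1OddDiamondG1H1_antitone {h h' : ℤ} (hh : h ≤ h') (H : SeedB1OddDiamondG1H1 h') :
    SeedB1OddDiamondG1H1 h := fun C hU hG hS =>
  H C ⟨fun Z hZ f => inDiamond_mono hh (hU.1 Z hZ f), fun P hP f => inDiamond_mono hh (hU.2 P hP f)⟩ hG hS
/-- a diamond letter is a cone letter. -/
theorem inCone_of_inDiamond {h : ℤ} {x : BPoint} (hx : InDiamond h x) : InCone x := ⟨hx.1, hx.2.1, hx.2.2.1⟩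

/-- the cone statement implies every `(T_h)`. (The converse — a finite support lies in some `◇_h` — is the content of
`seedB1OddCone_iff`, stated hypothesis-form below; together: `(T_∞) ↔ ∀ h, (T_h)`.) -/
theorem seedB1OddDiamondG1H1_of_cone (H : SeedB1OddConeG1H1) (h : ℤ) : SeedB1OddDiamondG1H1 h := fun C hU hG hS =>
  H C ⟨fun Z hZ f => inCone_of_inDiamond (hU.1 Z hZ f), fun P hP f => inCone_of_inDiamond (hU.2 P hP f)⟩ hG hS

/-- `(T_∞) ↔ ∀ h, (T_h)` (the missing half: take `h = max (α + c)` over the finitely many letters of `C`). -/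
def SeedB1OddConeIff : Prop := SeedB1OddConeG1H1 ↔ ∀ h : ℤ, SeedB1OddDiamondG1H1 h

/-! ## §2 The boost (light-cone translation `α ↦ α + s`, `β` fixed) — FIRST LEMMA of the line -/

/-- boost of a letter: `t·I + c·ℓ_u ↦ (t+s)·I + c·ℓ_u`. -/
abbrev boostPt (s : ℤ) (x : BPoint) : BPoint := (x.1 + s, x.2)
/-- boost of a cell, factorwise. -/
def MCell.boost (s : ℤ) (Z : MCell) : MCell := fun f => boostPt s (Z f)
/-- boost of a configuration (both levels; no level swap — contrast `MConfig.dual`). -/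
def MConfig.boostImage (s : ℤ) (C : MConfig) : MConfig := ⟨C.lower.image (MCell.boost s), C.upper.image (MCell.boost s)⟩

/-- **FIRST LEMMA (BOOST BLINDNESS OF H₁)**, stated as a `Prop` (PROVED in §7: `staticH1BoostInvariant_holds`). If `C` and its boost both lie in the cone (the only place a
sign of `α` is read: `EncDir` and the A2I guard `0 ≤ α`), then H₁-staticity, G₁-closure and odd-FC presence are unchanged.
Pencil: every conjunct of `RuleDMu4N∕P`, `XresXFires`, `XresA2IFires` reads `β`-components, DIFFERENCES of `α` across cells or
factors (`coord _ k ≠ coord _ k'`, `(q σ).1 < (Z σ).1`, `bsub`, `NullBelow`, `ray x k ((y).1 - (x).1)`), or the sign of `α` on a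
charged cone letter (`≥ 1` before and after); `perm`∕`delta`∕`pat`∕`FCc` read `β` only. (= translation principle (11.4)(A) of
bc5-plan memo v4.3 for RULE D ∕ PSC ∕ XClean, ×1 s4-ref g75; here for the typed H₁ families — to be proved like LEMMA T.) -/
def StaticH1BoostInvariant : Prop :=
  ∀ (s : ℤ) (C : MConfig), C.InCone → (C.boostImage s).InCone →
    (C.StaticH1 ↔ (C.boostImage s).StaticH1) ∧ (C.G1Closed ↔ (C.boostImage s).G1Closed) ∧
      (C.HasOddFC ↔ (C.boostImage s).HasOddFC)

/-- a support is FLOOR-ANCHORED: some letter of some present cell lies on the floor line `α = c` (`t = 0`). -/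
abbrev MConfig.FloorAnchored (C : MConfig) : Prop :=
  (∃ Z ∈ C.lower, ∃ f, OnFloor (Z f)) ∨ ∃ P ∈ C.upper, ∃ f, OnFloor (P f)
/-- `(T_h)` restricted to floor-anchored supports. -/
def SeedB1OddAnchored (h : ℤ) : Prop :=
  ∀ C : MConfig, C.InDiamond h → C.FloorAnchored → C.G1Closed → C.StaticH1 → ¬ C.HasOddFC

/-- **SPAN CONTROL (the reduction the first lemma buys)**: under boost blindness, `(T_h)` is equivalent to its floor-anchored
form — a non-anchored counterexample has all node levels `t ≥ 2` and boosts down by `2` inside `◇_{h-2} ⊆ ◇_h`; iterate on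
`min t`. So the only parameter of a counterexample is its SPAN (= top height once anchored). -/
def SpanControl : Prop := StaticH1BoostInvariant → ∀ h : ℤ, SeedB1OddAnchored h ↔ SeedB1OddDiamondG1H1 h

/-- boosts compose additively. -/
theorem boost_boost (Z : MCell) (s s' : ℤ) : (Z.boost s).boost s' = Z.boost (s + s') := by
  funext f
  refine Prod.ext ?_ rfl
  show (Z f).1 + s + s' = (Z f).1 + (s + s')
  ring

/-- the trivial boost. -/
theorem boost_zero (Z : MCell) : Z.boost 0 = Z := by
  funext f
  refine Prod.ext ?_ rfl
  show (Z f).1 + 0 = (Z f).1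
  simp

/-! ## §3 The law in `h` read off the census, typed: realisable diagonal units -/

/-- the diagonal unit `P`-cell `[t·I + ℓ_{i^k}]⁴`. -/
def diagUnit (t : ℤ) (k : Fin 4) : MCell := fun _ => diamondLetter t 1 k
/-- «the diagonal unit `[t·I+ℓ_u]⁴` is REALISABLE at height `h`»: present at level `P` in some H₁-static G₁-closed support in `◇_h`. -/
def DiagUnitRealisable (h t : ℤ) : Prop :=
  ∃ C : MConfig, C.InDiamond h ∧ C.G1Closed ∧ C.StaticH1 ∧ ∃ k, diagUnit t k ∈ C.upper

/-- realisability is monotone in `h` (same support, bigger diamond) — so the ◇₈ survivor `[6I+ℓ_u]⁴` (W-SEARCH-1's 14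
supports; j298438 model 8d3ee082b6d8b019; j309715 «ANY FC» SAT) is realisable at EVERY `h ≥ 8` as an INTERIOR diagonal unit:
the ceiling-unit law (CUL-h) ∕ (W′) does not extend verbatim beyond `h = 8`. -/
theorem diagUnitRealisable_mono {h h' t : ℤ} (hh : h ≤ h') (H : DiagUnitRealisable h t) : DiagUnitRealisable h' t := by
  obtain ⟨C, hU, hG, hS, k, hk⟩ := H
  exact ⟨C, ⟨fun Z hZ f => inDiamond_mono hh (hU.1 Z hZ f), fun P hP f => inDiamond_mono hh (hU.2 P hP f)⟩, hG, hS, k, hk⟩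

/-- under boost blindness realisability is also TRANSLATION-monotone: `[tI+ℓ]⁴` at `h` gives `[(t+2)I+ℓ]⁴` at `h+2`
(proved: `diagUnitRealisableBoost` §6 + `diagUnitRealisable_step` §7; with the previous lemma: at `◇₁₀` BOTH `[6I+ℓ_u]⁴` and
`[8I+ℓ_u]⁴` are realisable). -/
def DiagUnitRealisableBoost : Prop :=
  StaticH1BoostInvariant → ∀ h t : ℤ, 0 ≤ t → DiagUnitRealisable h t → DiagUnitRealisable (h + 2) (t + 2)

/-- **(DUL-h) the boost-invariant sharpening of (W′)** — the h-uniform typed target this lens proposes instead of the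
ceiling-unit law: every FC cell of an H₁-static G₁-closed support in `◇_h` is a DIAGONAL cell (all four letters equal; then
its pattern is `0000` or `1111`, even). At `h = 8` this is j309715's «FC with ≥ 2 distinct letters» UNSAT (third code ×1). -/
def SeedFCDiagonalDiamondG1H1 (h : ℤ) : Prop :=
  ∀ C : MConfig, C.InDiamond h → C.G1Closed → C.StaticH1 →
    ∀ Z : MCell, (Z ∈ C.lower ∨ Z ∈ C.upper) → FCc Z → ∀ f g : Fin 4, Z f = Z g

/-- a diagonal cell has a constant phase-bit pattern, hence not an odd one. -/
theorem not_oddPat_of_diagonal {Z : MCell} (hZ : ∀ f g : Fin 4, Z f = Z g) : ¬ OddPat Z.pat := by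
  have e1 := congrArg kbit (hZ 1 0)
  have e2 := congrArg kbit (hZ 2 0)
  have e3 := congrArg kbit (hZ 3 0)
  have hv : (Z.pat).val = 15 * kbit (Z 0) := by
    simp only [MCell.pat, e1, e2, e3]; ring
  have hk := kbit_le_one (Z 0)
  rcases Nat.le_one_iff_eq_zero_or_eq_one.mp hk with h0 | h0
  · have hp : Z.pat = 0 := Fin.ext (by rw [hv, h0]; rfl)
    rw [hp]; decide
  · have hp : Z.pat = 15 := Fin.ext (by rw [hv, h0]; rfl)
    rw [hp]; decide

/-- **(DUL-h) ⇒ (T_h)** at every height. -/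
theorem seedB1Odd_of_diagonal {h : ℤ} (H : SeedFCDiagonalDiamondG1H1 h) : SeedB1OddDiamondG1H1 h := by
  intro C hU hG hS hodd
  rcases hodd with ⟨Z, hZ, hfc, hpat⟩ | ⟨P, hP, hfc, hpat⟩
  · exact not_oddPat_of_diagonal (H C hU hG hS Z (Or.inl hZ) hfc) hpat
  · exact not_oddPat_of_diagonal (H C hU hG hS P (Or.inr hP) hfc) hpat

/-! ## §6 Glue PROVED: the boost is injective and commutes with `perm` ∕ `delta` ∕ `pat` ∕ `FCc`; hence the `G1Closed` and `HasOddFC`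
conjuncts of the first lemma hold OUTRIGHT, and `SpanControl`, `SeedB1OddConeIff`, `DiagUnitRealisableBoost` are theorems. What remains
of K1 is the `StaticH1` conjunct alone (`StaticH1BoostCore`, LEMMA-T-sized) — PROVED in §7. -/

section Glue

/-- the boost of letters is injective. -/
theorem boostPt_injective (s : ℤ) : Function.Injective (boostPt s) := by
  intro x y hxy
  have h1 := congrArg Prod.fst hxy
  have h2 := congrArg Prod.snd hxy
  simp only at h1 h2
  exact Prod.ext (by omega) h2

/-- the boost of cells is injective. -/
theorem boost_injective (s : ℤ) : Function.Injective (MCell.boost s) := by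
  intro Z W h
  funext f
  have hf := congrFun h f
  simp only [MCell.boost] at hf
  exact boostPt_injective s hf

/-- the boost commutes with factor permutations. -/
theorem boost_perm (s : ℤ) (σ : Equiv.Perm (Fin 4)) (Z : MCell) : (Z.boost s).perm σ = (Z.perm σ).boost s := rfl
/-- the boost commutes with the pairing `Δ`. -/
theorem boost_delta (s : ℤ) (Z : MCell) : (Z.boost s).delta = (Z.delta).boost s := rfl
/-- the boost preserves the phase-bit pattern. -/
theorem boost_pat (s : ℤ) (Z : MCell) : (Z.boost s).pat = Z.pat := rfl
/-- the boost preserves full charge. -/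
theorem boost_fcc (s : ℤ) (Z : MCell) : FCc (Z.boost s) ↔ FCc Z := Iff.rfl
/-- the boost preserves the absolute charge `c`. -/
theorem absCharge_boostPt (s : ℤ) (x : BPoint) : absCharge (boostPt s x) = absCharge x := rfl

/-- a closure property under an operation commuting with an injective map transports along the image. -/
theorem closed_image_iff {S : Finset MCell} {b op : MCell → MCell} (hb : Function.Injective b)
    (hc : ∀ Z, op (b Z) = b (op Z)) : (∀ W ∈ S.image b, op W ∈ S.image b) ↔ (∀ Z ∈ S, op Z ∈ S) := by
  constructor
  · intro H Z hZ
    have h1 : op (b Z) ∈ S.image b := H (b Z) (Finset.mem_image_of_mem b hZ)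
    rw [hc, Finset.mem_image] at h1
    obtain ⟨Z', hZ', he⟩ := h1
    rw [← hb he]
    exact hZ'
  · intro H W hW
    rw [Finset.mem_image] at hW
    obtain ⟨Z, hZ, rfl⟩ := hW
    rw [hc]
    exact Finset.mem_image_of_mem b (H Z hZ)

/-- `S₄`-closure is boost-invariant. -/
theorem permClosed_boost_iff (s : ℤ) (S : Finset MCell) : PermClosed (S.image (MCell.boost s)) ↔ PermClosed S :=
  forall_congr' fun σ =>
    closed_image_iff (op := fun Z => Z.perm σ) (b := MCell.boost s) (boost_injective s) (fun Z => boost_perm s σ Z)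
/-- `Δ`-closure is boost-invariant. -/
theorem deltaClosed_boost_iff (s : ℤ) (S : Finset MCell) : DeltaClosed (S.image (MCell.boost s)) ↔ DeltaClosed S :=
  closed_image_iff (op := MCell.delta) (b := MCell.boost s) (boost_injective s) (fun Z => boost_delta s Z)
/-- **the `G1Closed` conjunct of the first lemma, outright.** -/
theorem g1Closed_boost_iff (s : ℤ) (C : MConfig) : (C.boostImage s).G1Closed ↔ C.G1Closed := by
  simp only [MConfig.G1Closed, MConfig.boostImage, permClosed_boost_iff, deltaClosed_boost_iff]

/-- bounded `∃` over a boosted level, transported to the original level. -/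
theorem exists_image_boost {S : Finset MCell} {s : ℤ} {P : MCell → Prop} :
    (∃ W ∈ S.image (MCell.boost s), P W) ↔ ∃ Z ∈ S, P (Z.boost s) := by
  constructor
  · rintro ⟨W, hW, hP⟩
    obtain ⟨Z, hZ, rfl⟩ := Finset.mem_image.mp hW
    exact ⟨Z, hZ, hP⟩
  · rintro ⟨Z, hZ, hP⟩
    exact ⟨Z.boost s, Finset.mem_image_of_mem _ hZ, hP⟩

/-- **the `HasOddFC` conjunct of the first lemma, outright.** -/
theorem hasOddFC_boost_iff (s : ℤ) (C : MConfig) : (C.boostImage s).HasOddFC ↔ C.HasOddFC := by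
  show ((∃ Z ∈ C.lower.image (MCell.boost s), FCc Z ∧ OddPat Z.pat) ∨
      ∃ P ∈ C.upper.image (MCell.boost s), FCc P ∧ OddPat P.pat) ↔ _
  rw [exists_image_boost, exists_image_boost]
  simp only [boost_fcc, boost_pat, MConfig.HasOddFC]

/-- the core of K1: the `StaticH1` conjunct (RULE D, `X+`, `A2I−` under the boost) — PROVED in §7 `staticH1BoostCore_holds`. -/
def StaticH1BoostCore : Prop :=
  ∀ (s : ℤ) (C : MConfig), C.InCone → (C.boostImage s).InCone → (C.StaticH1 ↔ (C.boostImage s).StaticH1)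
/-- the first lemma follows from its `StaticH1` conjunct (the other two conjuncts hold outright). -/
theorem staticH1BoostInvariant_of_core (H : StaticH1BoostCore) : StaticH1BoostInvariant := fun s C hC hC' =>
  ⟨H s C hC hC', (g1Closed_boost_iff s C).symm, (hasOddFC_boost_iff s C).symm⟩

/-- a boosted diamond letter is a diamond letter, given the obvious bounds. -/
theorem inDiamond_boostPt {h h' s : ℤ} {x : BPoint} (hx : InDiamond h x) (hs : s % 2 = 0) (hlo : absCharge x ≤ x.1 + s)
    (hhi : x.1 + s + absCharge x ≤ h') : InDiamond h' (boostPt s x) := by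
  refine ⟨hx.1, ?_, ?_, ?_⟩
  · show absCharge (boostPt s x) ≤ x.1 + s
    rw [absCharge_boostPt]; exact hlo
  · show (x.1 + s - absCharge (boostPt s x)) % 2 = 0
    rw [absCharge_boostPt]; have := hx.2.2.1; omega
  · show x.1 + s + absCharge (boostPt s x) ≤ h'
    rw [absCharge_boostPt]; exact hhi

/-- the letters of a support. -/
def MConfig.letters (C : MConfig) : Finset BPoint := (C.lower ∪ C.upper).biUnion fun Z => Finset.univ.image Z
/-- a letter of a present cell is a letter of the support. -/
theorem mem_letters {C : MConfig} {Z : MCell} (hZ : Z ∈ C.lower ∨ Z ∈ C.upper) (f : Fin 4) : Z f ∈ C.letters := by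
  unfold MConfig.letters
  rw [Finset.mem_biUnion]
  exact ⟨Z, Finset.mem_union.mpr hZ, Finset.mem_image_of_mem Z (Finset.mem_univ f)⟩

/-- every letter of the support is a letter of some present cell. -/
theorem exists_of_mem_letters {C : MConfig} {x : BPoint} (hx : x ∈ C.letters) :
    ∃ Z, (Z ∈ C.lower ∨ Z ∈ C.upper) ∧ ∃ f, Z f = x := by
  unfold MConfig.letters at hx
  rw [Finset.mem_biUnion] at hx
  obtain ⟨Z, hZ, hx⟩ := hx
  rw [Finset.mem_image] at hx
  obtain ⟨f, -, hf⟩ := hx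
  exact ⟨Z, Finset.mem_union.mp hZ, f, hf⟩

/-- a support with an odd FC cell has a cell. -/
theorem exists_cell_of_hasOddFC {C : MConfig} (h : C.HasOddFC) : ∃ Z, Z ∈ C.lower ∨ Z ∈ C.upper := by
  rcases h with ⟨Z, hZ, -⟩ | ⟨P, hP, -⟩
  · exact ⟨Z, Or.inl hZ⟩
  · exact ⟨P, Or.inr hP⟩
/-- a support in `◇_h` lies in the open cone. -/
theorem inCone_of_inDiamond' {h : ℤ} {C : MConfig} (hU : C.InDiamond h) : C.InCone :=
  ⟨fun Z hZ f => inCone_of_inDiamond (hU.1 Z hZ f), fun P hP f => inCone_of_inDiamond (hU.2 P hP f)⟩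

/-- **SPAN CONTROL is a theorem** (given the first lemma): boost a counterexample down by its minimal node level. -/
theorem spanControl : SpanControl := by
  intro inv h
  constructor
  · intro HA C hU hG hS hodd
    obtain ⟨Z₀, hZ₀⟩ := exists_cell_of_hasOddFC hodd
    have hne : C.letters.Nonempty := ⟨Z₀ 0, mem_letters hZ₀ 0⟩
    obtain ⟨x₀, hx₀, hmin⟩ := Finset.exists_min_image C.letters (fun x => x.1 - absCharge x) hne
    have hdia : ∀ x ∈ C.letters, InDiamond h x := by
      intro x hx
      obtain ⟨Z, hZ, f, rfl⟩ := exists_of_mem_letters hx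
      rcases hZ with hZ | hZ
      · exact hU.1 Z hZ f
      · exact hU.2 Z hZ f
    have hx₀d := hdia x₀ hx₀
    set m := x₀.1 - absCharge x₀ with hm
    have hm0 : 0 ≤ m := by have := hx₀d.2.1; omega
    have hm2 : m % 2 = 0 := by have := hx₀d.2.2.1; omega
    have hU' : (C.boostImage (-m)).InDiamond h := by
      constructor
      · intro W hW f
        obtain ⟨Z, hZ, rfl⟩ := Finset.mem_image.mp hW
        have hx := hdia (Z f) (mem_letters (Or.inl hZ) f)
        have hle := hmin (Z f) (mem_letters (Or.inl hZ) f)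
        show InDiamond h (boostPt (-m) (Z f))
        exact inDiamond_boostPt hx (by omega) (by omega) (by have := hx.2.2.2; omega)
      · intro W hW f
        obtain ⟨Z, hZ, rfl⟩ := Finset.mem_image.mp hW
        have hx := hdia (Z f) (mem_letters (Or.inr hZ) f)
        have hle := hmin (Z f) (mem_letters (Or.inr hZ) f)
        show InDiamond h (boostPt (-m) (Z f))
        exact inDiamond_boostPt hx (by omega) (by omega) (by have := hx.2.2.2; omega)
    obtain ⟨hSi, hGi, hOi⟩ := inv (-m) C (inCone_of_inDiamond' hU) (inCone_of_inDiamond' hU')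
    have hA' : (C.boostImage (-m)).FloorAnchored := by
      obtain ⟨Z, hZ, f, hf⟩ := exists_of_mem_letters hx₀
      rcases hZ with hZ | hZ
      · refine Or.inl ⟨Z.boost (-m), Finset.mem_image_of_mem _ hZ, f, ?_⟩
        show (Z f).1 + -m = absCharge (boostPt (-m) (Z f))
        rw [absCharge_boostPt, hf]; omega
      · refine Or.inr ⟨Z.boost (-m), Finset.mem_image_of_mem _ hZ, f, ?_⟩
        show (Z f).1 + -m = absCharge (boostPt (-m) (Z f))
        rw [absCharge_boostPt, hf]; omega
    exact HA _ hU' hA' (hGi.mp hG) (hSi.mp hS) (hOi.mp hodd)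
  · intro HD C hU _hA hG hS
    exact HD C hU hG hS

/-- **`(T_∞) ↔ ∀ h, (T_h)` is a theorem**: a finite support lies in the diamond of its maximal causal height. -/
theorem seedB1OddConeIff : SeedB1OddConeIff := by
  refine ⟨seedB1OddDiamondG1H1_of_cone, fun H C hC hG hS hodd => ?_⟩
  obtain ⟨Z₀, hZ₀⟩ := exists_cell_of_hasOddFC hodd
  have hne : C.letters.Nonempty := ⟨Z₀ 0, mem_letters hZ₀ 0⟩
  obtain ⟨x₁, hx₁, hmax⟩ := Finset.exists_max_image C.letters (fun x => x.1 + absCharge x) hne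
  have hcone : ∀ x ∈ C.letters, InCone x := by
    intro x hx
    obtain ⟨Z, hZ, f, rfl⟩ := exists_of_mem_letters hx
    rcases hZ with hZ | hZ
    · exact hC.1 Z hZ f
    · exact hC.2 Z hZ f
  have hU : C.InDiamond (x₁.1 + absCharge x₁) := by
    constructor
    · intro Z hZ f
      have hx := hcone (Z f) (mem_letters (Or.inl hZ) f)
      have hle := hmax (Z f) (mem_letters (Or.inl hZ) f)
      exact ⟨hx.1, hx.2.1, hx.2.2, hle⟩
    · intro Z hZ f
      have hx := hcone (Z f) (mem_letters (Or.inr hZ) f)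
      have hle := hmax (Z f) (mem_letters (Or.inr hZ) f)
      exact ⟨hx.1, hx.2.1, hx.2.2, hle⟩
  exact H _ C hU hG hS hodd

/-- the boost of a diagonal unit is the diagonal unit `s` node levels up. -/
theorem boost_diagUnit (s t : ℤ) (k : Fin 4) : (diagUnit t k).boost s = diagUnit (t + s) k := by
  funext f
  simp [MCell.boost, boostPt, diagUnit, diamondLetter, ray, add_assoc, add_comm]

/-- **translation-monotonicity of realisable diagonal units is a theorem** (given the first lemma). -/
theorem diagUnitRealisableBoost : DiagUnitRealisableBoost := by
  rintro inv h t _ht ⟨C, hU, hG, hS, k, hk⟩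
  have hU' : (C.boostImage 2).InDiamond (h + 2) := by
    constructor
    · intro W hW f
      obtain ⟨Z, hZ, rfl⟩ := Finset.mem_image.mp hW
      have hx := hU.1 Z hZ f
      show InDiamond (h + 2) (boostPt 2 (Z f))
      exact inDiamond_boostPt hx (by decide) (by have := hx.2.1; omega) (by have := hx.2.2.2; omega)
    · intro W hW f
      obtain ⟨Z, hZ, rfl⟩ := Finset.mem_image.mp hW
      have hx := hU.2 Z hZ f
      show InDiamond (h + 2) (boostPt 2 (Z f))
      exact inDiamond_boostPt hx (by decide) (by have := hx.2.1; omega) (by have := hx.2.2.2; omega)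
  obtain ⟨hSi, hGi, -⟩ := inv 2 C (inCone_of_inDiamond' hU) (inCone_of_inDiamond' hU')
  refine ⟨C.boostImage 2, hU', hGi.mp hG, hSi.mp hS, k, ?_⟩
  show diagUnit (t + 2) k ∈ C.upper.image (MCell.boost 2)
  rw [← boost_diagUnit]
  exact Finset.mem_image_of_mem _ hk

/-- COROLLARY (the census correction, now conditional on `StaticH1BoostCore` only): at every `h ≥ 8` the diagonal units `[6I+ℓ_u]⁴` AND
`[8I+ℓ_u]⁴` are realisable at `◇_{h+2}` once `[6I+ℓ_u]⁴` is realisable at `◇_h` (j298438 model 8d3ee082b6d8b019 gives `h = 8`). -/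
theorem diagUnits_next_height (H : StaticH1BoostCore) {h : ℤ} (h6 : DiagUnitRealisable h 6) :
    DiagUnitRealisable (h + 2) 6 ∧ DiagUnitRealisable (h + 2) 8 :=
  ⟨diagUnitRealisable_mono (by omega) h6,
    by simpa using diagUnitRealisableBoost (staticH1BoostInvariant_of_core H) h 6 (by norm_num) h6⟩

end Glue

end Summit.Ventures.HSemireg.Pad4Tower
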